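import Literature.NumberTheory.Automorphic.StrongApproximationGL2
import Literature.NumberTheory.Automorphic.UnramifiedHeckeScalarsProofs
import Literature.NumberTheory.Automorphic.TestFunctionGLLeftInvariance
import Literature.NumberTheory.Automorphic.GLnAdelicStructureProofs
import Literature.NumberTheory.Automorphic.AdelicAdditiveCharacterDuality
import Literature.NumberTheory.Automorphic.AdelicSecondCountable
import Literature.NumberTheory.Automorphic.AdelicGLnGlue
import Literature.NumberTheory.Automorphic.TateLocalFactors
import Literature.NumberTheory.Automorphic.SmallRationalAdeles
import Literature.NumberTheory.Automorphic.UnramifiedHeckeLevel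
import HarnessLib

/-!
# The finite-adelic Fourier transform of Schwartz–Bruhat functions on `(𝔸_K^∞)^ι`

Topic `NumberTheory/Automorphic`; namespace `Literature.NumberTheory.Automorphic`. The finite half
of the verification that Schwartz–Bruhat functions on `𝔸_K^ι` (and on `M_n(𝔸_K)`, `ι = n × n`)
satisfy the hypotheses of the adelic Poisson summation formula
(`AdeleRing.pi_tsum_eq_inv_measure_mul_tsum_piFourierCoeff` of `AdelicPoissonSummation`) and that
their Fourier transforms are again Schwartz–Bruhat — the input of the functional equation of the
global zeta integrals of Godement–Jacquet (LNM 260, §11, proof of Thm. 11.2 via Poisson summation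
on `M_n(𝔸)`; Tate (1967), §3.2 locally and Lemma 4.2.4 globally for `n = 1`). Everything is proved:

* `finiteAdeleAddChar K` — the finite component `ψ_f(b) = ψ_K(0, b)` of Tate's standard character
  (`AdelicAdditiveCharacter.adeleAddChar`), the factorisation `ψ_K(x) = ψ_K(x_∞, 0) ψ_f(x_f)`
  (`adeleAddChar_eq_mul`), `ψ_f = 1` on `𝒪̂_K` and `ψ_f(k) = exp(2πi Tr_{K/ℚ} k)` for `k ∈ K`
  (`finiteAdeleAddChar_algebraMap`, `finiteAdeleAddChar_eq_of_forall_sub_mem`).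
* `exists_denominator_annihilator_levelIdeal` — **the annihilator of a level is bounded**
  (qualitative local duality, Tate (1967), §2.2): for a denominator `D` of the codifferent, every
  non-zero ideal `𝔫`, `c ∈ 𝔫` and `η ∈ 𝔸_K^∞` with `ψ_f(η l) = 1` for all `l ∈ 𝔫 𝒪̂_K`
  (`levelIdeal`), `D c η` is integral everywhere (strong approximation `𝔸_K^∞ = K + 𝒪̂_K` and the
  codifferent argument of `AdelicAdditiveCharacterDuality`).
* `piLevelIdeal`, `exists_piLevelIdeal_subset` — the level boxes `(𝔫 𝒪̂_K)^ι` are cofinal among the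
  neighbourhoods of `0`; `exists_level_of_mem_schwartzBruhat` — **every Schwartz–Bruhat function
  (locally constant, compactly supported; `SchwartzBruhat` of `TateLocalFactors`) has a level**;
  `exists_denominator_of_mem_schwartzBruhat` — and a denominator of its support.
* `finitePiFourier K μ Φ η = ∫ Φ(x) ψ_f(Σ_i η_i x_i) dμ(x)` and
  `finitePiFourier_mem_schwartzBruhat` — **the transform of a Schwartz–Bruhat function is
  Schwartz–Bruhat** (locally constant because the support has a denominator; compactly supported
  because the level bounds the denominators of the support of `Φ̂`,
  `exists_denominator_finitePiFourier_of_level`), with the bound `|Φ̂| ≤ ∫ |Φ|`, linearity, and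
  the rational form `exists_denominator_finitePiFourier_algebraMap` (`Φ̂(ξ) ≠ 0`, `ξ ∈ K^ι`,
  forces `e ξ ∈ (𝓞 K)^ι`) used for the summability of the Fourier coefficients over `K^ι`.

## References

* J. Tate, *Fourier analysis in number fields and Hecke's zeta-functions*, in J. W. S. Cassels,
  A. Fröhlich (eds.), *Algebraic Number Theory* (1967), Ch. XV, §2.2 (local duality, standard
  functions), §3.2, §4.1–4.2 [CasselsFrohlichANT1967].
* R. Godement, H. Jacquet, *Zeta functions of simple algebras*, LNM 260 (1972), §11
  [GodementJacquetLNM260].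
* A. Weil, *Basic Number Theory* (1967), Ch. IV §2, Ch. VII §2 [WeilBNT1967].
-/

noncomputable section

open MeasureTheory NumberField IsDedekindDomain Filter Topology
open scoped Circle

namespace Literature.NumberTheory.Automorphic

section FiniteChar

variable (K : Type) [Field K] [NumberField K]

/-- The inclusion `𝔸_K^∞ →ₙ+* 𝔸_K = K_∞ × 𝔸_K^∞`, `b ↦ (0, b)`, of the finite-adelic direct factor
(companion of `infiniteAdeleInl`). [folklore] -/
def finiteAdeleInr : FiniteAdeleRing (𝓞 K) K →ₙ+* AdeleRing (𝓞 K) K :=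
  (0 : FiniteAdeleRing (𝓞 K) K →ₙ+* InfiniteAdeleRing K).prod
    (NonUnitalRingHom.id (FiniteAdeleRing (𝓞 K) K))

/-- `finiteAdeleInr K b = (0, b)` (definitional). [folklore] -/
@[simp]
theorem finiteAdeleInr_apply (b : FiniteAdeleRing (𝓞 K) K) : finiteAdeleInr K b = (0, b) := rfl

/-- `b ↦ (0, b)` is continuous. [folklore] -/
theorem continuous_finiteAdeleInr : Continuous (finiteAdeleInr K) :=
  Continuous.prodMk continuous_const continuous_id

/-- **The finite-adelic component `ψ_f` of Tate's standard character**: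
`ψ_f(b) = ψ_K(0, b)`, an additive character of `𝔸_K^∞` (Tate, §4.1: `ψ = ∏_v ψ_v`, and `ψ_f` is the
product over the finite places). [folklore] -/
def finiteAdeleAddChar : AddChar (FiniteAdeleRing (𝓞 K) K) Circle :=
  (adeleAddChar K).compAddMonoidHom
    (finiteAdeleInr K : FiniteAdeleRing (𝓞 K) K →ₙ+* AdeleRing (𝓞 K) K).toAddMonoidHom

/-- Unfolding: `ψ_f(b) = ψ_K(0, b)`. [folklore] -/
theorem finiteAdeleAddChar_apply (b : FiniteAdeleRing (𝓞 K) K) :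
    finiteAdeleAddChar K b = adeleAddChar K ((0 : InfiniteAdeleRing K), b) := rfl

/-- `ψ_f` is continuous. [folklore] -/
theorem continuous_finiteAdeleAddChar : Continuous (finiteAdeleAddChar K) :=
  (continuous_adeleAddChar K).comp (continuous_finiteAdeleInr K)

/-- **`ψ_K = ψ_∞ ⊗ ψ_f`**: `ψ_K(x) = ψ_K(x_∞, 0) · ψ_f(x_f)`. [folklore] -/
theorem adeleAddChar_eq_mul (x : AdeleRing (𝓞 K) K) :
    adeleAddChar K x = adeleAddChar K (infiniteAdeleInl K x.1) * finiteAdeleAddChar K x.2 := by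
  rw [finiteAdeleAddChar_apply, infiniteAdeleInl_apply, ← AddChar.map_add_eq_mul]
  congr 1
  refine Prod.ext ?_ ?_
  · change x.1 = x.1 + 0
    rw [add_zero]
  · change x.2 = 0 + x.2
    rw [zero_add]

/-- `(0, b)` is a finite-integral adele iff `b ∈ ∏_v 𝒪_v`. [folklore] -/
theorem isFiniteIntegral_finiteAdeleInr_iff (b : FiniteAdeleRing (𝓞 K) K) :
    IsFiniteIntegral K (finiteAdeleInr K b) ↔ ∀ v, b v ∈ v.adicCompletionIntegers K :=
  Iff.rfl

/-- **`ψ_f` is trivial on `∏_v 𝒪_v`.** [folklore] -/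
theorem finiteAdeleAddChar_eq_one_of_forall_mem {b : FiniteAdeleRing (𝓞 K) K}
    (hb : ∀ v, b v ∈ v.adicCompletionIntegers K) : finiteAdeleAddChar K b = 1 := by
  have h := adeleAddChar_apply_of_isFiniteIntegral K ((isFiniteIntegral_finiteAdeleInr_iff K b).2 hb)
  rw [show (finiteAdeleInr K b).1 = 0 from rfl, map_zero, AddCircle.coe_zero, neg_zero,
    AddCircle.toCircle_zero] at h
  exact h

/-- **`ψ_f` through a global approximation**: if `b - k` is integral at every finite place
(`k ∈ K`) then `ψ_f(b) = exp(2πi Tr_{K/ℚ}(k))` (from `ψ_K(k) = 1` and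
`ψ_K(k_∞, 0) = exp(-2πi Tr(k))`). [folklore] -/
theorem finiteAdeleAddChar_eq_of_forall_sub_mem {b : FiniteAdeleRing (𝓞 K) K} {k : K}
    (hb : ∀ v, (b - algebraMap K (FiniteAdeleRing (𝓞 K) K) k) v ∈ v.adicCompletionIntegers K) :
    finiteAdeleAddChar K b =
      AddCircle.toCircle (((Algebra.trace ℚ K k : ℚ) : ℝ) : AddCircle (1 : ℝ)) := by
  have hfi : IsFiniteIntegral K (finiteAdeleInr K b - algebraMap K (AdeleRing (𝓞 K) K) k) := by
    intro v
    have h2 : (finiteAdeleInr K b - algebraMap K (AdeleRing (𝓞 K) K) k).2 =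
        b - algebraMap K (FiniteAdeleRing (𝓞 K) K) k := by
      rw [AdeleRing.snd_sub]
      rfl
    rw [h2]
    exact hb v
  change adeleAddChar K (finiteAdeleInr K b) = _
  rw [adeleAddChar_apply, adeleTraceMod_eq K hfi, AdeleRing.fst_sub,
    show (finiteAdeleInr K b).1 = 0 from rfl, zero_sub, map_neg, AdeleRing.algebraMap_fst,
    infiniteAdeleTrace_algebraMap, AddCircle.coe_neg, neg_neg]

/-- `ψ_f(k) = exp(2πi Tr_{K/ℚ}(k))` for a principal finite adele `k ∈ K`. [folklore] -/
theorem finiteAdeleAddChar_algebraMap (k : K) :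
    finiteAdeleAddChar K (algebraMap K (FiniteAdeleRing (𝓞 K) K) k) =
      AddCircle.toCircle (((Algebra.trace ℚ K k : ℚ) : ℝ) : AddCircle (1 : ℝ)) :=
  finiteAdeleAddChar_eq_of_forall_sub_mem K (k := k) fun v => by
    rw [sub_self]
    exact zero_mem _

/-- `exp(2πi t) = 1` forces `t ∈ ℤ`. [folklore] -/
theorem exists_int_eq_of_toCircle_eq_one {t : ℝ}
    (h : AddCircle.toCircle ((t : ℝ) : AddCircle (1 : ℝ)) = 1) : ∃ n : ℤ, (n : ℝ) = t := by
  rw [← AddCircle.toCircle_zero] at h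
  have h0 : ((t : ℝ) : AddCircle (1 : ℝ)) = 0 := AddCircle.injective_toCircle one_ne_zero h
  rw [AddCircle.coe_eq_zero_iff] at h0
  obtain ⟨n, hn⟩ := h0
  exact ⟨n, by simpa using hn⟩

end FiniteChar

/-! ### The annihilator of a level in `𝔸_K^∞` is bounded (Tate's local duality, qualitatively) -/

section Annihilator

variable (K : Type) [Field K] [NumberField K]

/-- A principal finite adele `c u` with `c ∈ 𝔫`, `u ∈ 𝓞 K` lies in the level `𝔫 𝒪̂_K`
(`levelIdeal`). [folklore] -/
theorem algebraMap_mul_mem_levelIdeal {𝔫 : Ideal (𝓞 K)} (h𝔫 : 𝔫 ≠ 0) {c : 𝓞 K} (hc : c ∈ 𝔫)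
    (u : 𝓞 K) :
    algebraMap K (FiniteAdeleRing (𝓞 K) K) ((c : K) * (u : K)) ∈ levelIdeal K 𝔫 := by
  intro v
  change Valued.v (((c : K) * (u : K) : K) : v.adicCompletion K) ≤ idealRadius K v 𝔫
  rw [HeightOneSpectrum.valuedAdicCompletion_eq_valuation',
    show (c : K) * (u : K) = algebraMap (𝓞 K) K (c * u) by simp,
    HeightOneSpectrum.valuation_of_algebraMap]
  exact intValuation_le_idealRadius_of_mem h𝔫 (Ideal.mul_mem_right u 𝔫 hc) v

/-- **The annihilator of a level is bounded** (the qualitative content of Tate's local duality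
`K_v^⊥ ≅ K_v`, `𝔞^⊥ = 𝔡⁻¹𝔞⁻¹`, Tate (1967), §2.2, Lemma 2.2.1 ff., summed over the finite places):
there is a non-zero global integer `D` (a denominator of the codifferent,
`exists_denominator_codifferent`) such that for every non-zero ideal `𝔫`, every `c ∈ 𝔫` and every
finite adele `η` with `ψ_f(η l) = 1` for all `l ∈ 𝔫 𝒪̂_K`, the finite adele `D c η` is integral at
every finite place. Proof: write `η = k + y`, `k ∈ K`, `y ∈ 𝒪̂_K` (strong approximation,
`FiniteAdeleRing.exists_forall_sub_algebraMap_mem`); testing against `l = c u`, `u ∈ 𝓞 K`, gives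
`exp(2πi Tr(k c u)) = 1`, so `c k` lies in the codifferent and `D c k ∈ 𝓞 K`.
[cite: CasselsFrohlichANT1967, Ch. XV (Tate), §2.2] -/
theorem exists_denominator_annihilator_levelIdeal :
    ∃ D : 𝓞 K, D ≠ 0 ∧ ∀ (𝔫 : Ideal (𝓞 K)), 𝔫 ≠ 0 → ∀ (c : 𝓞 K), c ∈ 𝔫 →
      ∀ η : FiniteAdeleRing (𝓞 K) K,
        (∀ l ∈ levelIdeal K 𝔫, finiteAdeleAddChar K (η * l) = 1) →
          ∀ v, (algebraMap K (FiniteAdeleRing (𝓞 K) K) ((D : K) * (c : K)) * η) v ∈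
            v.adicCompletionIntegers K := by
  obtain ⟨D, hD0, hD⟩ := exists_denominator_codifferent K
  refine ⟨D, hD0, fun 𝔫 h𝔫 c hc η hη => ?_⟩
  -- `η = k + y` with `y` integral
  obtain ⟨k, hk⟩ := FiniteAdeleRing.exists_forall_sub_algebraMap_mem (𝓞 K) K η
  -- `Tr (u c k) ∈ ℤ` for all `u ∈ 𝓞 K`
  have htr : ∀ u : 𝓞 K, ∃ n : ℤ, (n : ℚ) = Algebra.trace ℚ K ((u : K) * ((c : K) * k)) := by
    intro u
    have h1 := hη _ (algebraMap_mul_mem_levelIdeal K h𝔫 hc u)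
    -- split `η (c u) = (η - k)(c u) + k c u`
    have hsplit : η * algebraMap K (FiniteAdeleRing (𝓞 K) K) ((c : K) * (u : K)) =
        (η - algebraMap K (FiniteAdeleRing (𝓞 K) K) k) *
            algebraMap K (FiniteAdeleRing (𝓞 K) K) ((c : K) * (u : K)) +
          algebraMap K (FiniteAdeleRing (𝓞 K) K) (k * ((c : K) * (u : K))) := by
      rw [map_mul (algebraMap K (FiniteAdeleRing (𝓞 K) K)) k]
      ring
    have hint : finiteAdeleAddChar K ((η - algebraMap K (FiniteAdeleRing (𝓞 K) K) k) *
        algebraMap K (FiniteAdeleRing (𝓞 K) K) ((c : K) * (u : K))) = 1 := by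
      refine finiteAdeleAddChar_eq_one_of_forall_mem K fun v => ?_
      rw [FiniteAdeleRing.mul_apply']
      refine mul_mem (hk v) ?_
      change (((c : K) * (u : K) : K) : v.adicCompletion K) ∈ v.adicCompletionIntegers K
      rw [show (c : K) * (u : K) = algebraMap (𝓞 K) K (c * u) by simp]
      exact HeightOneSpectrum.coe_mem_adicCompletionIntegers v (c * u)
    rw [hsplit, AddChar.map_add_eq_mul, hint, one_mul, finiteAdeleAddChar_algebraMap] at h1
    obtain ⟨n, hn⟩ := exists_int_eq_of_toCircle_eq_one h1
    refine ⟨n, ?_⟩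
    have hn' : ((n : ℚ) : ℝ) = ((Algebra.trace ℚ K (k * ((c : K) * (u : K))) : ℚ) : ℝ) := by
      exact_mod_cast hn
    rw [show (u : K) * ((c : K) * k) = k * ((c : K) * (u : K)) by ring]
    exact_mod_cast hn'
  -- hence `D c k ∈ 𝓞 K`
  obtain ⟨r, hr⟩ := hD ((c : K) * k) htr
  have hdecomp : algebraMap K (FiniteAdeleRing (𝓞 K) K) ((D : K) * (c : K)) * η =
      algebraMap K (FiniteAdeleRing (𝓞 K) K) ((D : K) * (c : K)) *
          (η - algebraMap K (FiniteAdeleRing (𝓞 K) K) k) +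
        algebraMap K (FiniteAdeleRing (𝓞 K) K) (r : K) := by
    rw [hr, ← mul_assoc, map_mul (algebraMap K (FiniteAdeleRing (𝓞 K) K)) ((D : K) * (c : K)) k]
    ring
  intro v
  rw [hdecomp, show ∀ x y : FiniteAdeleRing (𝓞 K) K, (x + y) v = x v + y v from fun _ _ => rfl,
    FiniteAdeleRing.mul_apply']
  refine add_mem (mul_mem ?_ (hk v)) ?_
  · change (((D : K) * (c : K) : K) : v.adicCompletion K) ∈ v.adicCompletionIntegers K
    rw [show (D : K) * (c : K) = algebraMap (𝓞 K) K (D * c) by simp]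
    exact HeightOneSpectrum.coe_mem_adicCompletionIntegers v (D * c)
  · change ((r : K) : v.adicCompletion K) ∈ v.adicCompletionIntegers K
    rw [show (r : K) = algebraMap (𝓞 K) K r from rfl]
    exact HeightOneSpectrum.coe_mem_adicCompletionIntegers v r

end Annihilator

/-! ### Level boxes in `(𝔸_K^∞)^ι` and the uniform level of a Schwartz–Bruhat function -/

section UniformLevel

variable (K : Type) [Field K] [NumberField K] (ι : Type)

/-- `𝔪 𝒪̂_K ⊆ 𝔫 𝒪̂_K` for non-zero ideals `𝔪 ⊆ 𝔫`. [folklore] -/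
theorem levelIdeal_mono {𝔪 𝔫 : Ideal (𝓞 K)} (h𝔪 : 𝔪 ≠ 0) (h : 𝔪 ≤ 𝔫) :
    levelIdeal K 𝔪 ≤ levelIdeal K 𝔫 :=
  fun _ hx v => (hx v).trans (idealRadius_mono K v h𝔪 h)

/-- The **level box** `(𝔫 𝒪̂_K)^ι ⊆ (𝔸_K^∞)^ι` of an ideal `𝔫 ⊆ 𝓞 K`: vectors all of whose
coordinates lie in `𝔫 𝒪̂_K` (`levelIdeal`). These compact open subgroups form a basis of
neighbourhoods of `0` (`exists_piLevelIdeal_subset`). [folklore] -/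
def piLevelIdeal (𝔫 : Ideal (𝓞 K)) : AddSubgroup (ι → FiniteAdeleRing (𝓞 K) K) :=
  AddSubgroup.pi Set.univ fun _ => levelIdeal K 𝔫

variable {ι}

/-- Membership in a level box (definitional). [folklore] -/
theorem mem_piLevelIdeal_iff {𝔫 : Ideal (𝓞 K)} {l : ι → FiniteAdeleRing (𝓞 K) K} :
    l ∈ piLevelIdeal K ι 𝔫 ↔ ∀ i, l i ∈ levelIdeal K 𝔫 := by
  simp [piLevelIdeal, AddSubgroup.mem_pi]

/-- Level boxes are open. [folklore] -/
theorem isOpen_piLevelIdeal [Finite ι] (𝔫 : Ideal (𝓞 K)) :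
    IsOpen (piLevelIdeal K ι 𝔫 : Set (ι → FiniteAdeleRing (𝓞 K) K)) := by
  have h : (piLevelIdeal K ι 𝔫 : Set (ι → FiniteAdeleRing (𝓞 K) K)) =
      Set.pi Set.univ fun _ => (levelIdeal K 𝔫 : Set (FiniteAdeleRing (𝓞 K) K)) := by
    ext l
    simp [mem_piLevelIdeal_iff]
  rw [h]
  exact isOpen_set_pi Set.finite_univ fun _ _ => isOpen_levelIdeal 𝔫

/-- Level boxes decrease with the ideal. [folklore] -/
theorem piLevelIdeal_mono {𝔪 𝔫 : Ideal (𝓞 K)} (h𝔪 : 𝔪 ≠ 0) (h : 𝔪 ≤ 𝔫) :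
    piLevelIdeal K ι 𝔪 ≤ piLevelIdeal K ι 𝔫 := fun _ hl =>
  (mem_piLevelIdeal_iff K).2 fun i => levelIdeal_mono K h𝔪 h ((mem_piLevelIdeal_iff K).1 hl i)

/-- **Level boxes are cofinal among the neighbourhoods of `0` in `(𝔸_K^∞)^ι`** (coordinatewise
`FiniteAdeleRing.exists_forall_valued_le_idealRadius_imp_mem`, and the product of the finitely
many ideals found). [folklore] -/
theorem exists_piLevelIdeal_subset [Fintype ι] {U : Set (ι → FiniteAdeleRing (𝓞 K) K)}
    (hU : U ∈ 𝓝 (0 : ι → FiniteAdeleRing (𝓞 K) K)) :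
    ∃ 𝔫 : Ideal (𝓞 K), 𝔫 ≠ 0 ∧ (piLevelIdeal K ι 𝔫 : Set (ι → FiniteAdeleRing (𝓞 K) K)) ⊆ U := by
  classical
  rw [nhds_pi, Filter.mem_pi] at hU
  obtain ⟨I, -, t, ht, hIt⟩ := hU
  have h1 : ∀ i, ∃ 𝔫 : Ideal (𝓞 K), 𝔫 ≠ 0 ∧
      ∀ x : FiniteAdeleRing (𝓞 K) K, (∀ v, Valued.v (x v) ≤ idealRadius K v 𝔫) → x ∈ t i :=
    fun i => FiniteAdeleRing.exists_forall_valued_le_idealRadius_imp_mem K (ht i)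
  choose 𝔫 h𝔫 hsub using h1
  have hprod : (∏ i, 𝔫 i) ≠ 0 := Finset.prod_ne_zero_iff.2 fun i _ => h𝔫 i
  refine ⟨∏ i, 𝔫 i, hprod, fun l hl => hIt fun i _ => hsub i (l i) fun v => ?_⟩
  have hli : l i ∈ levelIdeal K (∏ j, 𝔫 j) := (mem_piLevelIdeal_iff K).1 hl i
  exact (levelIdeal_mono K hprod
    (Ideal.prod_le_inf.trans (Finset.inf_le (Finset.mem_univ i))) hli) v

/-- **A Schwartz–Bruhat function on `(𝔸_K^∞)^ι` has a level**: a locally constant, compactly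
supported `Φ` is invariant under translation by the level box of some non-zero ideal `𝔫`,
`Φ(x + l) = Φ(x)` for all `x` and all `l ∈ (𝔫 𝒪̂_K)^ι` (cover the support by finitely many cosets
of level boxes on which `Φ` is constant and take the product of the ideals; Weil's "standard
functions", Tate (1967), §3.2 / Godement–Jacquet, LNM 260, Ch. II §10). [folklore] -/
theorem exists_level_of_mem_schwartzBruhat [Fintype ι] {Φ : (ι → FiniteAdeleRing (𝓞 K) K) → ℂ}
    (hΦ : Φ ∈ SchwartzBruhat (ι → FiniteAdeleRing (𝓞 K) K)) :
    ∃ 𝔫 : Ideal (𝓞 K), 𝔫 ≠ 0 ∧ ∀ x, ∀ l ∈ piLevelIdeal K ι 𝔫, Φ (x + l) = Φ x := by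
  classical
  obtain ⟨hlc, hcs⟩ := (mem_schwartzBruhat_iff).1 hΦ
  -- a level at each point
  have hloc : ∀ x, ∃ 𝔫 : Ideal (𝓞 K), 𝔫 ≠ 0 ∧
      ∀ l ∈ piLevelIdeal K ι 𝔫, Φ (x + l) = Φ x := by
    intro x
    have hU : {l : ι → FiniteAdeleRing (𝓞 K) K | Φ (x + l) = Φ x} ∈
        𝓝 (0 : ι → FiniteAdeleRing (𝓞 K) K) := by
      refine ((hlc.isOpen_fiber (Φ x)).preimage (continuous_const.add continuous_id)).mem_nhds ?_
      simp
    obtain ⟨𝔫, h𝔫, hsub⟩ := exists_piLevelIdeal_subset K hU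
    exact ⟨𝔫, h𝔫, fun l hl => hsub hl⟩
  choose 𝔫 h𝔫 hlev using hloc
  -- the cosets `x + (𝔫_x 𝒪̂)^ι` cover the support; extract a finite subcover
  set O : (ι → FiniteAdeleRing (𝓞 K) K) → Set (ι → FiniteAdeleRing (𝓞 K) K) :=
    fun x => (fun l => x + l) '' (piLevelIdeal K ι (𝔫 x) : Set (ι → FiniteAdeleRing (𝓞 K) K))
    with hO
  have hOo : ∀ x, IsOpen (O x) := fun x =>
    (Homeomorph.addLeft x).isOpenMap _ (isOpen_piLevelIdeal K (𝔫 x))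
  have hcover : tsupport Φ ⊆ ⋃ x, O x := fun x _ =>
    Set.mem_iUnion.2 ⟨x, 0, zero_mem _, add_zero x⟩
  obtain ⟨T, hT⟩ := hcs.elim_finite_subcover O hOo hcover
  have hprod : (∏ x ∈ T, 𝔫 x) ≠ 0 := Finset.prod_ne_zero_iff.2 fun x _ => h𝔫 x
  have hle : ∀ x ∈ T, piLevelIdeal K ι (∏ y ∈ T, 𝔫 y) ≤ piLevelIdeal K ι (𝔫 x) := fun x hx =>
    piLevelIdeal_mono K hprod (Ideal.prod_le_inf.trans (Finset.inf_le hx))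
  refine ⟨∏ x ∈ T, 𝔫 x, hprod, ?_⟩
  -- on the support
  have hA : ∀ y ∈ tsupport Φ, ∀ l ∈ piLevelIdeal K ι (∏ x ∈ T, 𝔫 x), Φ (y + l) = Φ y := by
    intro y hy l hl
    obtain ⟨x, hxT, hyx⟩ := Set.mem_iUnion₂.1 (hT hy)
    obtain ⟨l₀, hl₀, rfl⟩ := hyx
    have h1 : Φ (x + l₀) = Φ x := hlev x l₀ hl₀
    have h2 : Φ (x + l₀ + l) = Φ x := by
      rw [add_assoc]
      exact hlev x (l₀ + l) (add_mem hl₀ (hle x hxT hl))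
    rw [h2, h1]
  intro y l hl
  by_cases hy : y ∈ tsupport Φ
  · exact hA y hy l hl
  by_cases hy' : y + l ∈ tsupport Φ
  · have h := hA (y + l) hy' (-l) (neg_mem hl)
    rw [add_neg_cancel_right] at h
    exact h.symm
  rw [image_eq_zero_of_notMem_tsupport hy, image_eq_zero_of_notMem_tsupport hy']

/-- **Compact support bounds the denominators**: for a Schwartz–Bruhat function `Φ` on
`(𝔸_K^∞)^ι` there is a non-zero global integer `d` with `d x_i` integral at every finite place
whenever `Φ(x) ≠ 0` (`FiniteAdeleRing.exists_ne_zero_forall_mem_mul_mem` for the compact set of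
coordinates of the support). [folklore] -/
theorem exists_denominator_of_mem_schwartzBruhat [Finite ι] {Φ : (ι → FiniteAdeleRing (𝓞 K) K) → ℂ}
    (hΦ : Φ ∈ SchwartzBruhat (ι → FiniteAdeleRing (𝓞 K) K)) :
    ∃ d : 𝓞 K, d ≠ 0 ∧ ∀ x, Φ x ≠ 0 → ∀ (i : ι) (v : HeightOneSpectrum (𝓞 K)),
      (algebraMap (𝓞 K) (FiniteAdeleRing (𝓞 K) K) d * x i) v ∈ v.adicCompletionIntegers K := by
  obtain ⟨_, hcs⟩ := (mem_schwartzBruhat_iff).1 hΦ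
  set B : Set (FiniteAdeleRing (𝓞 K) K) :=
    ⋃ i : ι, (fun x : ι → FiniteAdeleRing (𝓞 K) K => x i) '' tsupport Φ with hB
  have hBc : IsCompact B := isCompact_iUnion fun i => hcs.image (continuous_apply i)
  obtain ⟨d, hd, hdB⟩ := FiniteAdeleRing.exists_ne_zero_forall_mem_mul_mem (K := K) hBc
  refine ⟨d, hd, fun x hx i v => hdB (x i) ?_ v⟩
  rw [hB]
  exact Set.mem_iUnion.2 ⟨i, x, subset_tsupport _ hx, rfl⟩

/-- The set `(d 𝒪̂_K)^ι` of `d`-multiples of integral vectors is a neighbourhood of `0` (it is the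
image of the open box `𝒪̂_K^ι` under the homeomorphism `z ↦ d z`, `d ≠ 0` being a unit of
`𝔸_K^∞`). [folklore] -/
theorem image_mul_integral_mem_nhds_zero [Finite ι] {d : 𝓞 K} (hd : d ≠ 0) :
    (fun z : ι → FiniteAdeleRing (𝓞 K) K => fun i =>
        algebraMap (𝓞 K) (FiniteAdeleRing (𝓞 K) K) d * z i) ''
      {z | ∀ i v, z i v ∈ v.adicCompletionIntegers K} ∈ 𝓝 (0 : ι → FiniteAdeleRing (𝓞 K) K) := by
  -- `d` is a unit of `𝔸_K^∞`
  have hdK : (d : K) ≠ 0 := by exact_mod_cast hd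
  set a : FiniteAdeleRing (𝓞 K) K := algebraMap (𝓞 K) (FiniteAdeleRing (𝓞 K) K) d with ha
  set b : FiniteAdeleRing (𝓞 K) K := algebraMap K (FiniteAdeleRing (𝓞 K) K) (d : K)⁻¹ with hb
  have hab : a * b = 1 := by
    rw [ha, hb, IsScalarTower.algebraMap_apply (𝓞 K) K (FiniteAdeleRing (𝓞 K) K), ← map_mul,
      show algebraMap (𝓞 K) K d = (d : K) from rfl, mul_inv_cancel₀ hdK, map_one]
  have hba : b * a = 1 := by rw [mul_comm, hab]
  -- the homeomorphism `z ↦ d z`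
  let e : (ι → FiniteAdeleRing (𝓞 K) K) ≃ₜ (ι → FiniteAdeleRing (𝓞 K) K) :=
    { toFun := fun z i => a * z i
      invFun := fun z i => b * z i
      left_inv := fun z => funext fun i => by simp [← mul_assoc, hba]
      right_inv := fun z => funext fun i => by simp [← mul_assoc, hab]
      continuous_toFun := continuous_pi fun i => continuous_const.mul (continuous_apply i)
      continuous_invFun := continuous_pi fun i => continuous_const.mul (continuous_apply i) }
  change e '' {z | ∀ i v, z i v ∈ v.adicCompletionIntegers K} ∈ 𝓝 (0 : ι → FiniteAdeleRing (𝓞 K) K)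
  refine (e.isOpenMap _ ?_).mem_nhds ⟨0, fun i v => ?_, funext fun i => ?_⟩
  · have : {z : ι → FiniteAdeleRing (𝓞 K) K | ∀ i v, z i v ∈ v.adicCompletionIntegers K} =
        Set.pi Set.univ fun _ =>
          {a : FiniteAdeleRing (𝓞 K) K | ∀ v, a v ∈ v.adicCompletionIntegers K} := by
      ext z; simp
    rw [this]
    exact isOpen_set_pi Set.finite_univ fun _ _ => FiniteAdeleRing.isOpen_setOf_forall_mem (𝓞 K) K
  · exact zero_mem _
  · change a * 0 = 0
    rw [mul_zero]

/-- The image of the integral box under `z ↦ e⁻¹ z` is compact and contains every vector with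
denominator `e`. [folklore] -/
theorem exists_isCompact_forall_denominator_mem {e : 𝓞 K} (he : e ≠ 0) :
    ∃ S : Set (ι → FiniteAdeleRing (𝓞 K) K), IsCompact S ∧
      ∀ η : ι → FiniteAdeleRing (𝓞 K) K, (∀ (i : ι) (v : HeightOneSpectrum (𝓞 K)),
        (algebraMap (𝓞 K) (FiniteAdeleRing (𝓞 K) K) e * η i) v ∈ v.adicCompletionIntegers K) →
          η ∈ S := by
  have heK : (e : K) ≠ 0 := by exact_mod_cast he
  refine ⟨(fun z : ι → FiniteAdeleRing (𝓞 K) K => fun i =>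
      algebraMap K (FiniteAdeleRing (𝓞 K) K) (e : K)⁻¹ * z i) ''
    (Set.pi Set.univ fun _ => {a : FiniteAdeleRing (𝓞 K) K | ∀ v, a v ∈ v.adicCompletionIntegers K}),
    ?_, fun η hη => ?_⟩
  · refine (isCompact_univ_pi fun _ => ?_).image (continuous_pi fun i =>
      continuous_const.mul (continuous_apply i))
    exact isCompact_integralFiniteAdeles K
  · refine ⟨fun i => algebraMap (𝓞 K) (FiniteAdeleRing (𝓞 K) K) e * η i,
      fun i _ => hη i, funext fun i => ?_⟩
    simp only
    rw [IsScalarTower.algebraMap_apply (𝓞 K) K (FiniteAdeleRing (𝓞 K) K), ← mul_assoc,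
      ← map_mul, show algebraMap (𝓞 K) K e = (e : K) from rfl, inv_mul_cancel₀ heK, map_one,
      one_mul]

end UniformLevel

/-! ### The finite-adelic Fourier transform -/

section Transform

attribute [local instance] secondCountableTopology_finiteAdeleRing

variable (K : Type) [Field K] [NumberField K] {ι : Type} [Fintype ι]
  [MeasurableSpace (FiniteAdeleRing (𝓞 K) K)] [BorelSpace (FiniteAdeleRing (𝓞 K) K)]
  (μ : Measure (ι → FiniteAdeleRing (𝓞 K) K))

/-- The **finite-adelic Fourier transform** on `(𝔸_K^∞)^ι` for the pairing
`⟨η, x⟩ = Σ_i η_i x_i` and the finite component `ψ_f` of Tate's character: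
`Φ̂(η) = ∫ Φ(x) ψ_f(Σ_i η_i x_i) dμ(x)` (`μ` an additive Haar measure; Tate (1967), §3.2 locally,
§4.2 globally; Godement–Jacquet, LNM 260, §11 on `M_n`). [folklore] -/
def finitePiFourier (Φ : (ι → FiniteAdeleRing (𝓞 K) K) → ℂ) (η : ι → FiniteAdeleRing (𝓞 K) K) : ℂ :=
  ∫ x, Φ x * finiteAdeleAddChar K (∑ i, η i * x i) ∂μ

omit [BorelSpace (FiniteAdeleRing (𝓞 K) K)] in
/-- Unfolding of `finitePiFourier`. [folklore] -/
theorem finitePiFourier_apply (Φ : (ι → FiniteAdeleRing (𝓞 K) K) → ℂ)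
    (η : ι → FiniteAdeleRing (𝓞 K) K) :
    finitePiFourier K μ Φ η = ∫ x, Φ x * finiteAdeleAddChar K (∑ i, η i * x i) ∂μ := rfl

omit [BorelSpace (FiniteAdeleRing (𝓞 K) K)] in
/-- `|Φ̂(η)| ≤ ∫ |Φ|`. [folklore] -/
theorem norm_finitePiFourier_le (Φ : (ι → FiniteAdeleRing (𝓞 K) K) → ℂ)
    (η : ι → FiniteAdeleRing (𝓞 K) K) :
    ‖finitePiFourier K μ Φ η‖ ≤ ∫ x, ‖Φ x‖ ∂μ := by
  rw [finitePiFourier_apply]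
  refine (norm_integral_le_integral_norm _).trans (le_of_eq (integral_congr_ae
    (Eventually.of_forall fun x => ?_)))
  simp only [norm_mul, Circle.norm_coe, mul_one]

/-- The transform is linear: additivity. [folklore] -/
theorem finitePiFourier_add {Φ Ψ : (ι → FiniteAdeleRing (𝓞 K) K) → ℂ}
    (hΦ : Integrable Φ μ) (hΨ : Integrable Ψ μ) (η : ι → FiniteAdeleRing (𝓞 K) K) :
    finitePiFourier K μ (Φ + Ψ) η = finitePiFourier K μ Φ η + finitePiFourier K μ Ψ η := by
  simp only [finitePiFourier_apply, Pi.add_apply, add_mul]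
  have hc : Continuous fun x : ι → FiniteAdeleRing (𝓞 K) K =>
      (finiteAdeleAddChar K (∑ i, η i * x i) : ℂ) :=
    continuous_subtype_val.comp ((continuous_finiteAdeleAddChar K).comp
      (continuous_finsetSum _ fun i _ => continuous_const.mul (continuous_apply i)))
  have hb : ∀ x : ι → FiniteAdeleRing (𝓞 K) K, ‖(finiteAdeleAddChar K (∑ i, η i * x i) : ℂ)‖ ≤ 1 :=
    fun x => by rw [Circle.norm_coe]
  exact integral_add (hΦ.mul_bdd hc.aestronglyMeasurable (ae_of_all _ hb))
    (hΨ.mul_bdd hc.aestronglyMeasurable (ae_of_all _ hb))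

omit [BorelSpace (FiniteAdeleRing (𝓞 K) K)] in
/-- The transform is linear: homogeneity. [folklore] -/
theorem finitePiFourier_smul (c : ℂ) (Φ : (ι → FiniteAdeleRing (𝓞 K) K) → ℂ)
    (η : ι → FiniteAdeleRing (𝓞 K) K) :
    finitePiFourier K μ (c • Φ) η = c * finitePiFourier K μ Φ η := by
  simp only [finitePiFourier_apply, Pi.smul_apply, smul_eq_mul, mul_assoc, integral_const_mul]

omit [BorelSpace (FiniteAdeleRing (𝓞 K) K)] in
/-- **The transform of a function with bounded denominators is invariant under `(d 𝒪̂_K)^ι`**: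
if `d x_i` is integral whenever `Φ(x) ≠ 0`, then `Φ̂(η + d z) = Φ̂(η)` for every integral vector
`z` (`ψ_f` is trivial on `𝒪̂_K`). [folklore] -/
theorem finitePiFourier_add_of_denominator {Φ : (ι → FiniteAdeleRing (𝓞 K) K) → ℂ} {d : 𝓞 K}
    (hd : ∀ x, Φ x ≠ 0 → ∀ (i : ι) (v : HeightOneSpectrum (𝓞 K)),
      (algebraMap (𝓞 K) (FiniteAdeleRing (𝓞 K) K) d * x i) v ∈ v.adicCompletionIntegers K)
    (η : ι → FiniteAdeleRing (𝓞 K) K) {z : ι → FiniteAdeleRing (𝓞 K) K}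
    (hz : ∀ i v, z i v ∈ v.adicCompletionIntegers K) :
    finitePiFourier K μ Φ (η + fun i => algebraMap (𝓞 K) (FiniteAdeleRing (𝓞 K) K) d * z i) =
      finitePiFourier K μ Φ η := by
  simp only [finitePiFourier_apply]
  refine integral_congr_ae (Eventually.of_forall fun x => ?_)
  by_cases hx : Φ x = 0
  · simp only [hx, zero_mul]
  have hint : finiteAdeleAddChar K
      (∑ i, algebraMap (𝓞 K) (FiniteAdeleRing (𝓞 K) K) d * z i * x i) = 1 := by
    refine finiteAdeleAddChar_eq_one_of_forall_mem K fun v => ?_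
    rw [show (∑ i, algebraMap (𝓞 K) (FiniteAdeleRing (𝓞 K) K) d * z i * x i) v =
      ∑ i, (algebraMap (𝓞 K) (FiniteAdeleRing (𝓞 K) K) d * z i * x i) v from
        map_sum (RestrictedProduct.evalRingHom _ v) _ _]
    refine sum_mem fun i _ => ?_
    rw [show algebraMap (𝓞 K) (FiniteAdeleRing (𝓞 K) K) d * z i * x i =
      z i * (algebraMap (𝓞 K) (FiniteAdeleRing (𝓞 K) K) d * x i) by ring,
      FiniteAdeleRing.mul_apply']
    exact mul_mem (hz i v) (hd x hx i v)
  simp only [Pi.add_apply, add_mul, Finset.sum_add_distrib, AddChar.map_add_eq_mul, hint,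
    mul_one]

omit [BorelSpace (FiniteAdeleRing (𝓞 K) K)] in
/-- **The transform of a Schwartz–Bruhat function is locally constant** (it is invariant under the
open subgroup `(d 𝒪̂_K)^ι`, `d` a denominator of the support). [folklore] -/
theorem isLocallyConstant_finitePiFourier {Φ : (ι → FiniteAdeleRing (𝓞 K) K) → ℂ}
    (hΦ : Φ ∈ SchwartzBruhat (ι → FiniteAdeleRing (𝓞 K) K)) :
    IsLocallyConstant (finitePiFourier K μ Φ) := by
  obtain ⟨d, hd, hden⟩ := exists_denominator_of_mem_schwartzBruhat K hΦ
  refine (IsLocallyConstant.iff_exists_open _).2 fun η => ?_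
  set M : Set (ι → FiniteAdeleRing (𝓞 K) K) :=
    (fun z : ι → FiniteAdeleRing (𝓞 K) K => fun i =>
        algebraMap (𝓞 K) (FiniteAdeleRing (𝓞 K) K) d * z i) ''
      {z | ∀ i v, z i v ∈ v.adicCompletionIntegers K} with hM
  have hM0 : M ∈ 𝓝 (0 : ι → FiniteAdeleRing (𝓞 K) K) := image_mul_integral_mem_nhds_zero K hd
  refine ⟨{η' | η' - η ∈ interior M}, isOpen_interior.preimage (continuous_id.sub continuous_const),
    by simpa using mem_interior_iff_mem_nhds.2 hM0, fun η' hη' => ?_⟩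
  obtain ⟨z, hz, hzη⟩ := interior_subset hη'
  have hzη' : (fun i => algebraMap (𝓞 K) (FiniteAdeleRing (𝓞 K) K) d * z i) = η' - η := hzη
  have : η' = η + fun i => algebraMap (𝓞 K) (FiniteAdeleRing (𝓞 K) K) d * z i := by
    rw [hzη']; abel
  rw [this, finitePiFourier_add_of_denominator K μ hden η hz]

/-- Schwartz–Bruhat functions are integrable for every Haar (indeed every locally finite) measure.
[folklore] -/
theorem integrable_of_mem_schwartzBruhat [IsFiniteMeasureOnCompacts μ]
    {Φ : (ι → FiniteAdeleRing (𝓞 K) K) → ℂ}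
    (hΦ : Φ ∈ SchwartzBruhat (ι → FiniteAdeleRing (𝓞 K) K)) : Integrable Φ μ :=
  hΦ.1.continuous.integrable_of_hasCompactSupport hΦ.2

variable [μ.IsAddLeftInvariant]

/-- **Translation covariance**: if `Φ(x + l) = Φ(x)` for all `x` then
`Φ̂(η) = ψ_f(Σ η_i l_i) Φ̂(η)`; hence `Φ̂(η) ≠ 0` forces `ψ_f(Σ η_i l_i) = 1` (invariance of the
Haar integral under `x ↦ l + x`). [folklore] -/
theorem finiteAdeleAddChar_eq_one_of_finitePiFourier_ne_zero
    {Φ : (ι → FiniteAdeleRing (𝓞 K) K) → ℂ} {l : ι → FiniteAdeleRing (𝓞 K) K}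
    (hl : ∀ x, Φ (x + l) = Φ x) {η : ι → FiniteAdeleRing (𝓞 K) K}
    (hη : finitePiFourier K μ Φ η ≠ 0) : finiteAdeleAddChar K (∑ i, η i * l i) = 1 := by
  have hcov : finitePiFourier K μ Φ η =
      (finiteAdeleAddChar K (∑ i, η i * l i) : ℂ) * finitePiFourier K μ Φ η := by
    rw [finitePiFourier_apply]
    conv_lhs => rw [← integral_add_left_eq_self _ l]
    simp only [add_comm l, hl, Pi.add_apply, mul_add, Finset.sum_add_distrib,
      AddChar.map_add_eq_mul, Circle.coe_mul, ← integral_const_mul]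
    refine integral_congr_ae (Eventually.of_forall fun x => ?_)
    ring
  have h1 : (1 - (finiteAdeleAddChar K (∑ i, η i * l i) : ℂ)) * finitePiFourier K μ Φ η = 0 := by
    rw [sub_mul, one_mul, ← hcov, sub_self]
  have h2 : (finiteAdeleAddChar K (∑ i, η i * l i) : ℂ) = 1 := by
    have := (mul_eq_zero.1 h1).resolve_right hη
    exact (sub_eq_zero.1 this).symm
  exact Circle.coe_eq_one.1 h2

/-- **Finite level bounds the support of the transform**: if `Φ` has level `𝔫 ≠ 0` then there is a
non-zero global integer `e` such that `e η_i` is integral at every finite place, for every `i`,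
whenever `Φ̂(η) ≠ 0` (test the covariance against the coordinate vectors `c u 1_i`, `c ∈ 𝔫`,
`u ∈ 𝓞 K`, and apply `exists_denominator_annihilator_levelIdeal`). [folklore] -/
theorem exists_denominator_finitePiFourier_of_level {Φ : (ι → FiniteAdeleRing (𝓞 K) K) → ℂ}
    {𝔫 : Ideal (𝓞 K)} (h𝔫 : 𝔫 ≠ 0) (hlev : ∀ x, ∀ l ∈ piLevelIdeal K ι 𝔫, Φ (x + l) = Φ x) :
    ∃ e : 𝓞 K, e ≠ 0 ∧ ∀ η, finitePiFourier K μ Φ η ≠ 0 → ∀ (i : ι) (v : HeightOneSpectrum (𝓞 K)),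
      (algebraMap (𝓞 K) (FiniteAdeleRing (𝓞 K) K) e * η i) v ∈ v.adicCompletionIntegers K := by
  classical
  obtain ⟨D, hD0, hD⟩ := exists_denominator_annihilator_levelIdeal K
  obtain ⟨c, hc𝔫, hc0⟩ := Submodule.exists_mem_ne_zero_of_ne_bot
    (show 𝔫 ≠ ⊥ by rwa [Ne, ← Submodule.zero_eq_bot])
  refine ⟨D * c, mul_ne_zero hD0 hc0, fun η hη i v => ?_⟩
  have hann : ∀ l ∈ levelIdeal K 𝔫, finiteAdeleAddChar K (η i * l) = 1 := by
    intro l hl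
    have h := finiteAdeleAddChar_eq_one_of_finitePiFourier_ne_zero K μ
      (l := Pi.single i l) (fun x => hlev x _ ((mem_piLevelIdeal_iff K).2 fun j => by
        by_cases hj : j = i
        · subst hj; simpa using hl
        · simp [Pi.single_eq_of_ne hj, zero_mem])) hη
    simpa [Pi.single_apply, mul_ite, mul_zero, Finset.sum_ite_eq'] using h
  have h := hD 𝔫 h𝔫 c hc𝔫 (η i) hann v
  rwa [IsScalarTower.algebraMap_apply (𝓞 K) K (FiniteAdeleRing (𝓞 K) K), map_mul,
    show algebraMap (𝓞 K) K D * algebraMap (𝓞 K) K c = (D : K) * (c : K) from rfl]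

/-- **The finite-adelic Fourier transform preserves the Schwartz–Bruhat space**
`𝒮((𝔸_K^∞)^ι)` (locally constant: `isLocallyConstant_finitePiFourier`; compactly supported: the
level of `Φ` bounds the denominators of the support of `Φ̂`, which therefore lies in a compact
`e⁻¹ 𝒪̂_K^ι`). Tate (1967), §3.2 (local), Godement–Jacquet, LNM 260, §11 (`M_n(𝔸)`); Weil,
*Basic Number Theory*, VII §2. [folklore] -/
theorem finitePiFourier_mem_schwartzBruhat {Φ : (ι → FiniteAdeleRing (𝓞 K) K) → ℂ}
    (hΦ : Φ ∈ SchwartzBruhat (ι → FiniteAdeleRing (𝓞 K) K)) :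
    finitePiFourier K μ Φ ∈ SchwartzBruhat (ι → FiniteAdeleRing (𝓞 K) K) := by
  refine (mem_schwartzBruhat_iff).2 ⟨isLocallyConstant_finitePiFourier K μ hΦ, ?_⟩
  obtain ⟨𝔫, h𝔫, hlev⟩ := exists_level_of_mem_schwartzBruhat K hΦ
  obtain ⟨e, he, hsupp⟩ := exists_denominator_finitePiFourier_of_level K μ h𝔫 hlev
  obtain ⟨S, hS, hSmem⟩ := exists_isCompact_forall_denominator_mem K (ι := ι) he
  refine HasCompactSupport.intro hS fun η hη => ?_
  by_contra hne
  exact hη (hSmem η (hsupp η hne))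

/-- **Rational support of the transform**: for `Φ ∈ 𝒮((𝔸_K^∞)^ι)` there is a non-zero global
integer `e` such that `Φ̂(ξ) ≠ 0` at a rational vector `ξ ∈ K^ι` forces `e ξ_i ∈ 𝓞 K` for all `i`
(the hypothesis "summable Fourier coefficients over a lattice" of the Poisson summation formula).
[folklore] -/
theorem exists_denominator_finitePiFourier_algebraMap {Φ : (ι → FiniteAdeleRing (𝓞 K) K) → ℂ}
    (hΦ : Φ ∈ SchwartzBruhat (ι → FiniteAdeleRing (𝓞 K) K)) :
    ∃ e : 𝓞 K, e ≠ 0 ∧ ∀ ξ : ι → K,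
      finitePiFourier K μ Φ (fun i => algebraMap K (FiniteAdeleRing (𝓞 K) K) (ξ i)) ≠ 0 →
        ∀ i, ∃ r : 𝓞 K, (r : K) = (e : K) * ξ i := by
  obtain ⟨𝔫, h𝔫, hlev⟩ := exists_level_of_mem_schwartzBruhat K hΦ
  obtain ⟨e, he, hsupp⟩ := exists_denominator_finitePiFourier_of_level K μ h𝔫 hlev
  refine ⟨e, he, fun ξ hξ i => ?_⟩
  have h := hsupp _ hξ i
  obtain ⟨r, hr⟩ := exists_algebraMap_eq_of_forall_coe_mem (𝓞 K) K ((e : K) * ξ i) fun v => by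
    have hv := h v
    rwa [IsScalarTower.algebraMap_apply (𝓞 K) K (FiniteAdeleRing (𝓞 K) K), ← map_mul] at hv
  exact ⟨r, hr⟩

end Transform

end Literature.NumberTheory.Automorphic
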